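import Literature.MathematicalPhysics.QuantumFieldTheory.Balaban1983to89.HiggsFluctMeasureExpMoments

/-!
# `Balaban1983to89.HiggsFluctFamilyDensity` — T. Bałaban, *(Higgs)₂,₃ quantum fields in a finite volume. III.
Renormalization*, Commun. Math. Phys. **88** (1983) 411–445 [Balaban1983Higgs3], (1.4) p. 412 with paper I,
Commun. Math. Phys. **85** (1982) 603–626 [Balaban1982Higgs1], (3.35) p. 618: **the product measure
`Π_{j=0}^{k−1} dμ_{C^{(j),L^jη}}(A′_j)` of (1.4) IS the normalised Gaussian density
`(Π_j Z_j⁻¹)·Π_j exp(−½⟨A′_j,(C^{(j),L^jη})^{−1}A′_j⟩)` times Lebesgue measure `Π_j dA′_j`** — the dictionary between III's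
`dμ` and I's explicit Gaussian integrals (3.35), AT THE LEVEL OF THE WHOLE FAMILY (the one-field dictionary is
`HiggsFluctMeasure.integral_fluctMeasure`), PROVED; theorems only

statement-level skeleton of published theorems with citation tags; proofs where landed; nothing here is a claim about the Yang–Mills mass gap

PDFs held: `paper:balaban1983-higgs-2-3-quantum-fields-finite-volume` (journal page = PDF page + 410) and
`paper:balaban1982-cmp85-higgs23-i` (journal page = PDF page + 602).

CITATION HEADER (lean-in-tree rule).  lit-balaban typed skeleton (HOME `run/shared/lean/pub/lit-balaban/`), typer line (the
typer's own carriers `HiggsFluctMeasure.fluctMeasure/fluctFamily`); located member of SKELETON row **B3.Eq1.4** (owner r15;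
cells only, zero head weight); the input of the typer's `B3FluctFieldWick` (Gaussian integration by parts on the family).
THE SOURCE TEXT.  III (1.4) p. 412 [PDF 2]: the renormalization transformation written with *"Π_{j=0}^{k−1} ∫dμ_{C^{(j),L^jη}}(A′_j)"*;
I (3.35) p. 618 [PDF 16], the same integrals written as `(a(L^{j+1}ε)^{d−2}/2π)^{(d/2)|T₁^{(j+1)}|} ∫dA′_j exp(−½⟨A′_j,
(C^{(j),L^jε})^{−1}A′_j⟩)(…)`, i.e. `Z^{(j)}·∫(…)dμ_{C^{(j)}}`; I p. 617: *"The fields A′_j … are independent Gaussian random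
variables with the covariances C^{(j),L^jε}"*.

WHAT IS PROVED (0 sorry; theorems only; nothing re-declared).  `msq > 0` (↤ `m²`), `a > 0`, `L > 1`, `k ≤ K`.
* `fluctMeasure_apply` — one factor: `dμ_{C^{(j)}}(S) = Z_j⁻¹ ∫_S e^{−½⟨A′,(C^{(j)})^{−1}A′⟩}dA′`.
* **`fluctFamily_eq_density`** — `Π_{j<k} dμ_{C^{(j),L^jη}} = (Π_j Z_j⁻¹)·(Π_j e^{−½⟨A′_j,(C^{(j)})^{−1}A′_j⟩})·Π_j dA′_j`
  (the two measures agree on boxes `Π_j S_j`: Fubini for the product density, `Measure.pi_eq`).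
* `integral_fluctFamily` — `∫ Ψ Π_j dμ_{C^{(j)}} = (Π_j Z_j⁻¹) ∫ (Π_j e^{−½⟨A′_j,(C^{(j)})^{−1}A′_j⟩}) Ψ Π_j dA′_j`;
  `integrable_fluctFamily_iff`; exponential-growth integrability `integrable_fluctFamily_of_abs_le`,
  `integrable_mul_famWeight_of_abs_le` (from `HiggsFluctMeasureExpMoments.integrable_exp_mul_norm_fluctFamily`).
HONEST SCOPE.  Measure-theoretic bookkeeping only; nothing of III beyond the product structure of (1.4) is asserted.  Unit
`lit-balaban-typer` gen 30 (literature-prover-lit-balaban-typer-g30-0); HOME/FILED.md records the proposal.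
-/

open scoped BigOperators ENNReal InnerProductSpace
open _root_.MeasureTheory

namespace Literature.MathematicalPhysics.QuantumFieldTheory.Balaban1983to89.HiggsFluctFamilyDensity

open Literature.MathematicalPhysics.QuantumFieldTheory.Balaban1983to89.HiggsLattice
open Literature.MathematicalPhysics.QuantumFieldTheory.Balaban1983to89.B3MultiscaleFields
open Literature.MathematicalPhysics.QuantumFieldTheory.Balaban1983to89.HiggsFluctMeasure
open Literature.MathematicalPhysics.QuantumFieldTheory.Balaban1983to89.HiggsFluctMeasurePos
open Literature.MathematicalPhysics.QuantumFieldTheory.Balaban1983to89.HiggsFluctMeasureExpMoments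

variable {P : HiggsLattice.Params}

/-! ## 1. The measure of (1.4) as a density times Lebesgue measure ((I.3.35)) -/

section Density

variable {msq a : ℝ}

/-- Scales below the top scale are `≤ K`. [cite: Balaban1983Higgs3, (1.4) p.412] -/
theorem le_K_of_fin {k : ℕ} (hk : k ≤ P.K) (j : Fin k) : (j : ℕ) ≤ P.K := (Nat.le_of_lt j.isLt).trans hk

/-- The density `Π_j e^{−½⟨A′_j,(C^{(j)})^{−1}A′_j⟩}` of (I.3.35) is positive. [cite: Balaban1982Higgs1, (3.35) p.618] -/
theorem famWeight_pos (msq a : ℝ) {k : ℕ} (F : (j : Fin k) → HiggsLattice.VecField P j) :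
    0 < ∏ j : Fin k, gaussWeight P msq a j (F j) :=
  Finset.prod_pos fun j _ => gaussWeight_pos msq a j (F j)

/-- The density of (I.3.35) is continuous. [cite: Balaban1982Higgs1, (3.35) p.618] -/
theorem continuous_famWeight (msq a : ℝ) (k : ℕ) :
    Continuous fun F : (j : Fin k) → HiggsLattice.VecField P j => ∏ j : Fin k, gaussWeight P msq a j (F j) :=
  continuous_finsetProd _ fun j _ => (continuous_gaussWeight msq a j).comp (continuous_apply j)

/-- On a box `Π_j s_j` the density restricted to the box is the product of the restricted factors.
[cite: Balaban1982Higgs1, (3.35) p.618] -/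
theorem indicator_pi_famWeight (msq a : ℝ) {k : ℕ} (s : (j : Fin k) → Set (HiggsLattice.VecField P j))
    (F : (j : Fin k) → HiggsLattice.VecField P j) :
    (Set.univ.pi s).indicator (fun G : (j : Fin k) → HiggsLattice.VecField P j => ∏ j : Fin k, gaussWeight P msq a j (G j)) F
      = ∏ j : Fin k, (s j).indicator (gaussWeight P msq a j) (F j) := by
  by_cases hF : F ∈ Set.univ.pi s
  · rw [Set.indicator_of_mem hF]
    exact Finset.prod_congr rfl fun j _ => (Set.indicator_of_mem (hF j (Set.mem_univ j)) _).symm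
  · rw [Set.indicator_of_notMem hF]
    obtain ⟨j, hj⟩ : ∃ j, F j ∉ s j := by simpa [Set.mem_univ_pi, not_forall] using hF
    exact (Finset.prod_eq_zero (Finset.mem_univ j) (Set.indicator_of_notMem hj _)).symm

/-- The measure `dμ_{C^{(j),L^jη}}` of a measurable set: `Z_j⁻¹ ∫_S e^{−½⟨A′,(C^{(j)})^{−1}A′⟩} dA′` ((1.4) ↔ (I.3.35), one factor).
[cite: Balaban1983Higgs3, (1.4) p.412] -/
theorem fluctMeasure_apply (hmsq : 0 < msq) (ha : 0 < a) (hL : 1 < (P.L : ℝ)) {j : ℕ} (hj : j ≤ P.K)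
    {S : Set (HiggsLattice.VecField P j)} (hS : MeasurableSet S) :
    fluctMeasure P msq a j S
      = ENNReal.ofReal ((gaussNorm P msq a j)⁻¹) * ENNReal.ofReal (∫ A in S, gaussWeight P msq a j A) := by
  rw [fluctMeasure_eq, Measure.smul_apply, withDensity_apply _ hS, smul_eq_mul,
    ← ENNReal.ofReal_inv_of_pos (gaussNorm_pos hmsq ha hL hj),
    ← ofReal_integral_eq_lintegral_ofReal (integrable_gaussWeight hmsq ha hL hj).integrableOn
      (Filter.Eventually.of_forall fun A => gaussWeight_nonneg msq a j A)]

/-- **(1.4) ↔ (I.3.35): the product measure `Π_{j<k} dμ_{C^{(j),L^jη}}(A′_j)` is the density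
`(Π_j Z_j⁻¹)·Π_j e^{−½⟨A′_j,(C^{(j),L^jη})^{−1}A′_j⟩}` times Lebesgue measure `Π_j dA′_j`** (the two measures agree on boxes,
hence everywhere); `msq > 0`, `a > 0`, `L > 1`, `k ≤ K`. PROVED. [cite: Balaban1983Higgs3, (1.4) p.412] -/
theorem fluctFamily_eq_density (hmsq : 0 < msq) (ha : 0 < a) (hL : 1 < (P.L : ℝ)) {k : ℕ} (hk : k ≤ P.K) :
    fluctFamily P msq a k
      = ENNReal.ofReal (∏ j : Fin k, (gaussNorm P msq a j)⁻¹) •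
        (volume : Measure ((j : Fin k) → HiggsLattice.VecField P j)).withDensity
          (fun F => ENNReal.ofReal (∏ j : Fin k, gaussWeight P msq a j (F j))) := by
  haveI : ∀ j : Fin k, IsProbabilityMeasure (fluctMeasure P msq a j) :=
    fun j => fluctMeasure_isProbability hmsq ha hL (le_K_of_fin hk j)
  rw [fluctFamily_eq]
  refine Measure.pi_eq fun s hs => ?_
  rw [Measure.smul_apply, withDensity_apply _ (MeasurableSet.univ_pi hs), smul_eq_mul]
  have hint : Integrable (fun F : (j : Fin k) → HiggsLattice.VecField P j => ∏ j : Fin k, gaussWeight P msq a j (F j)) := by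
    have h := Integrable.fintype_prod_dep
      (f := fun (j : Fin k) (A : HiggsLattice.VecField P j) => gaussWeight P msq a j A)
      (μ := fun j => volume) fun j => integrable_gaussWeight hmsq ha hL (le_K_of_fin hk j)
    rwa [← volume_pi] at h
  rw [← ofReal_integral_eq_lintegral_ofReal hint.integrableOn
      (Filter.Eventually.of_forall fun F => (famWeight_pos msq a F).le),
    ← integral_indicator (MeasurableSet.univ_pi hs)]
  simp_rw [indicator_pi_famWeight]
  have hI : ∀ j : Fin k, 0 ≤ ∫ A : HiggsLattice.VecField P j, (s j).indicator (gaussWeight P msq a j) A :=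
    fun j => integral_nonneg fun A => Set.indicator_nonneg (fun B _ => gaussWeight_nonneg msq a j B) A
  have hZ : ∀ j : Fin k, 0 ≤ (gaussNorm P msq a j)⁻¹ := fun j => inv_nonneg.2 (gaussNorm_nonneg msq a j)
  rw [integral_fintype_prod_volume_eq_prod
      (fun (j : Fin k) (A : HiggsLattice.VecField P j) => (s j).indicator (gaussWeight P msq a j) A),
    ENNReal.ofReal_prod_of_nonneg fun j _ => hI j, ENNReal.ofReal_prod_of_nonneg fun j _ => hZ j,
    ← Finset.prod_mul_distrib]
  refine Finset.prod_congr rfl fun j _ => ?_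
  rw [fluctMeasure_apply hmsq ha hL (le_K_of_fin hk j) (hs j), integral_indicator (hs j)]

/-- **Integration against `Π_j dμ_{C^{(j),L^jη}}` is the normalised Gaussian integral of (I.3.35)**:
`∫ Ψ Π_j dμ_{C^{(j)}} = (Π_j Z_j)⁻¹ ∫ Π_j e^{−½⟨A′_j,(C^{(j)})^{−1}A′_j⟩} Ψ(A′) Π_j dA′_j`. [cite: Balaban1983Higgs3, (1.4) p.412] -/
theorem integral_fluctFamily (hmsq : 0 < msq) (ha : 0 < a) (hL : 1 < (P.L : ℝ)) {k : ℕ} (hk : k ≤ P.K)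
    {E : Type*} [NormedAddCommGroup E] [NormedSpace ℝ E] (Ψ : ((j : Fin k) → HiggsLattice.VecField P j) → E) :
    ∫ F, Ψ F ∂(fluctFamily P msq a k)
      = (∏ j : Fin k, (gaussNorm P msq a j)⁻¹) •
          ∫ F : (j : Fin k) → HiggsLattice.VecField P j, (∏ j : Fin k, gaussWeight P msq a j (F j)) • Ψ F := by
  rw [fluctFamily_eq_density hmsq ha hL hk, integral_smul_measure,
    integral_withDensity_eq_integral_toReal_smul₀ (continuous_famWeight msq a k).measurable.ennreal_ofReal.aemeasurable
      (Filter.Eventually.of_forall fun _ => ENNReal.ofReal_lt_top)]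
  have h0 : 0 ≤ ∏ j : Fin k, (gaussNorm P msq a j)⁻¹ :=
    Finset.prod_nonneg fun j _ => inv_nonneg.2 (gaussNorm_nonneg msq a j)
  simp only [ENNReal.toReal_ofReal h0, ENNReal.toReal_ofReal (famWeight_pos msq a _).le]

/-- Integrability against `Π_j dμ_{C^{(j),L^jη}}` is integrability of `Ψ·density` against Lebesgue measure.
[cite: Balaban1983Higgs3, (1.4) p.412] -/
theorem integrable_fluctFamily_iff (hmsq : 0 < msq) (ha : 0 < a) (hL : 1 < (P.L : ℝ)) {k : ℕ} (hk : k ≤ P.K)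
    (Ψ : ((j : Fin k) → HiggsLattice.VecField P j) → ℝ) :
    Integrable Ψ (fluctFamily P msq a k)
      ↔ Integrable fun F : (j : Fin k) → HiggsLattice.VecField P j => Ψ F * ∏ j : Fin k, gaussWeight P msq a j (F j) := by
  have hpos : 0 < ∏ j : Fin k, (gaussNorm P msq a j)⁻¹ :=
    Finset.prod_pos fun j _ => inv_pos.2 (gaussNorm_pos hmsq ha hL (le_K_of_fin hk j))
  rw [fluctFamily_eq_density hmsq ha hL hk, integrable_smul_measure (ENNReal.ofReal_pos.2 hpos).ne' ENNReal.ofReal_ne_top,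
    integrable_withDensity_iff (continuous_famWeight msq a k).measurable.ennreal_ofReal
      (Filter.Eventually.of_forall fun _ => ENNReal.ofReal_lt_top)]
  refine integrable_congr (Filter.Eventually.of_forall fun F => ?_)
  simp only [ENNReal.toReal_ofReal (famWeight_pos msq a F).le]

/-- A continuous function of exponential growth is integrable against `Π_j dμ_{C^{(j),L^jη}}` (exponential moments,
`HiggsFluctMeasureExpMoments.integrable_exp_mul_norm_fluctFamily`). [cite: Balaban1983Higgs3, (1.4) p.412] -/
theorem integrable_fluctFamily_of_abs_le (hmsq : 0 < msq) (ha : 0 < a) (hL : 1 < (P.L : ℝ)) {k : ℕ} (hk : k ≤ P.K)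
    {Ψ : ((j : Fin k) → HiggsLattice.VecField P j) → ℝ} (hΨ : Continuous Ψ) {K t : ℝ}
    (hb : ∀ F, |Ψ F| ≤ K * Real.exp (t * ‖F‖)) : Integrable Ψ (fluctFamily P msq a k) := by
  refine ((integrable_exp_mul_norm_fluctFamily hmsq ha hL hk t).const_mul K).mono' hΨ.aestronglyMeasurable
    (Filter.Eventually.of_forall fun F => ?_)
  rw [Real.norm_eq_abs]
  exact hb F

/-- The same against the density times Lebesgue measure. [cite: Balaban1983Higgs3, (1.4) p.412] -/
theorem integrable_mul_famWeight_of_abs_le (hmsq : 0 < msq) (ha : 0 < a) (hL : 1 < (P.L : ℝ)) {k : ℕ} (hk : k ≤ P.K)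
    {Ψ : ((j : Fin k) → HiggsLattice.VecField P j) → ℝ} (hΨ : Continuous Ψ) {K t : ℝ}
    (hb : ∀ F, |Ψ F| ≤ K * Real.exp (t * ‖F‖)) :
    Integrable fun F : (j : Fin k) → HiggsLattice.VecField P j => Ψ F * ∏ j : Fin k, gaussWeight P msq a j (F j) :=
  (integrable_fluctFamily_iff hmsq ha hL hk Ψ).1 (integrable_fluctFamily_of_abs_le hmsq ha hL hk hΨ hb)

end Density

end Literature.MathematicalPhysics.QuantumFieldTheory.Balaban1983to89.HiggsFluctFamilyDensity
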